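import Literature.Computability.QuantumComplexity.HadamardSandwich
import Literature.Computability.QuantumComplexity.RevGadgets
import Literature.Computability.QuantumComplexity.RevUncompute
import HarnessLib

/-!
# Conjugated phases: computing a predicate, kicking a phase, uncomputing

Topic `Literature/Computability/QuantumComplexity`; a step in the discharge of
`ajl_jonesApproxProblem_mem_PromiseBQP` (the middle operator of the Hadamard-sandwich gadget,
`HadamardSandwich.lean`). For a well-formed classical reversible program `ops` (NOT/CNOT/Toffoli on
`Fin N`), lists of "`S`-flag" wires `Fs` and "`Z`-flag" wires `Fz`, the Clifford+T gate list

  `phaseKickGates ops h Fs Fz = revCompile ops ++ (S on each Fs) ++ (S S on each Fz) ++ revCompile ops.reverse`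

has the **diagonal** matrix `phaseDiag (phaseKickExp ops Fs Fz)`, where
`phaseKickExp ops Fs Fz y = #{f ∈ Fs | (clEval ops y) f} + 2 · #{f ∈ Fz | (clEval ops y) f}` (conjugating
the diagonal phase by the permutation `clEval ops` keeps it diagonal; Bennett's compute–uncompute,
Nielsen–Chuang 2010, §3.2.5, with a phase in between = phase kick-back, §6.1.1). No cleanliness
hypothesis is needed for diagonality; the *value* of the exponent on clean inputs is supplied by the
program's specification (e.g. `SLP.BExpr.clEval_compile`).

## References

* M. A. Nielsen, I. L. Chuang, *Quantum Computation and Quantum Information*, CUP 2010, §3.2.5,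
  §6.1.1 [NielsenChuang2010].
-/

noncomputable section

namespace Literature.Computability.QuantumComplexity

open Matrix Cryptography

variable {N : ℕ}

/-! ### Matrices determined by basis states -/

/-- Two matrices agreeing on all basis states are equal (Mathlib's `Matrix.ext_of_mulVec_single` for
`basisState`; kept un-namespaced so as not to create a `….QuantumComplexity.Matrix` namespace that
would shadow `_root_.Matrix` and its scoped notation in importing files). [folklore] -/
theorem matrix_ext_of_mulVec_basisState {M M' : Matrix (QReg N) (QReg N) ℂ}
    (h : ∀ w, M *ᵥ basisState w = M' *ᵥ basisState w) : M = M' := by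
  ext x w
  have := congrFun (h w) x
  rwa [mulVec_basisState, mulVec_basisState] at this

/-- A diagonal phase matrix on a basis state. [folklore] -/
theorem phaseDiag_mulVec_basisState (g : QReg N → ℕ) (w : QReg N) :
    phaseDiag g *ᵥ basisState w = (Complex.I ^ g w) • basisState w := by
  ext x
  rw [mulVec_basisState]
  simp only [phaseDiag, Matrix.diagonal_apply, Pi.smul_apply, basisState, smul_eq_mul]
  by_cases h : x = w
  · subst h; simp
  · simp [h]

/-! ### Layers of `S` gates -/

/-- `S` on each wire of `Fs` (in order). [folklore] -/
def sLayer (Fs : List (Fin N)) : QCircuit cliffordT N := ⟨Fs.map sOn⟩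

/-- `S²  = Z` on each wire of `Fz`. [folklore] -/
def zLayer (Fz : List (Fin N)) : QCircuit cliffordT N := ⟨Fz.flatMap fun f => [sOn f, sOn f]⟩

/-- The number of wires of `Fs` set in `w`. [folklore] -/
def countOn (Fs : List (Fin N)) (w : QReg N) : ℕ := Fs.countP fun f => w f

/-- The `S`-layer multiplies `|w⟩` by `i^{#set wires}`. [folklore] -/
theorem sLayer_mulVec_basisState (A : Language Bool) : ∀ (Fs : List (Fin N)) (w : QReg N),
    (sLayer Fs).toMatrix A *ᵥ basisState w = (Complex.I ^ countOn Fs w) • basisState w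
  | [], w => by simp [sLayer, countOn]
  | f :: Fs, w => by
    have ih := sLayer_mulVec_basisState A Fs w
    simp only [sLayer, List.map_cons, QCircuit.toMatrix_cons] at ih ⊢
    rw [← Matrix.mulVec_mulVec, sOn_mulVec_basisState, Matrix.mulVec_smul, ih, smul_smul]
    simp only [countOn, List.countP_cons]
    cases w f <;> simp [pow_succ, mul_comm]

/-- The `Z`-layer multiplies `|w⟩` by `(−1)^{#set wires} = i^{2·#}`. [folklore] -/
theorem zLayer_mulVec_basisState (A : Language Bool) : ∀ (Fz : List (Fin N)) (w : QReg N),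
    (zLayer Fz).toMatrix A *ᵥ basisState w = (Complex.I ^ (2 * countOn Fz w)) • basisState w
  | [], w => by simp [zLayer, countOn]
  | f :: Fz, w => by
    have ih := zLayer_mulVec_basisState A Fz w
    simp only [zLayer, List.flatMap_cons] at ih ⊢
    rw [show (⟨[sOn f, sOn f] ++ Fz.flatMap fun f => [sOn f, sOn f]⟩ : QCircuit cliffordT N) =
      (⟨[sOn f, sOn f]⟩ : QCircuit cliffordT N).append ⟨Fz.flatMap fun f => [sOn f, sOn f]⟩ from rfl, QCircuit.toMatrix_append,
      ← Matrix.mulVec_mulVec]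
    rw [show (⟨[sOn f, sOn f]⟩ : QCircuit cliffordT N).toMatrix A = (sOn f).toMatrix A * (sOn f).toMatrix A by
      simp [QCircuit.toMatrix_cons]]
    rw [← Matrix.mulVec_mulVec, sOn_mulVec_basisState, Matrix.mulVec_smul, sOn_mulVec_basisState, Matrix.mulVec_smul,
      Matrix.mulVec_smul, ih, smul_smul, smul_smul]
    simp only [countOn, List.countP_cons]
    cases w f
    · simp
    · simp only [if_true, Nat.mul_add, mul_one, pow_add]
      congr 1
      ring

/-! ### The conjugated phase program -/

/-- The exponent of `i` kicked onto `|y⟩`: `#S-flags + 2·#Z-flags` set after running `ops` on `y`.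
[folklore] -/
def phaseKickExp (ops : List (ClOp (Fin N))) (Fs Fz : List (Fin N)) (y : QReg N) : ℕ :=
  countOn Fs (clEval ops y) + 2 * countOn Fz (clEval ops y)

/-- **The phase-kick program**: compute, `S`-layer, `Z`-layer, uncompute. [cite: NielsenChuang2010, §3.2.5] -/
def phaseKickCircuit (ops : List (ClOp (Fin N))) (h : ∀ op ∈ ops, op.WF) (Fs Fz : List (Fin N)) : QCircuit cliffordT N :=
  ⟨revCompile (toRevList ops h) ++ (sLayer Fs).gates ++ (zLayer Fz).gates ++ revCompile (toRevList ops.reverse (wf_reverse h))⟩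

/-- The phase-kick program on a basis state: a phase, nothing else. [cite: NielsenChuang2010, §3.2.5] -/
theorem phaseKickCircuit_mulVec_basisState (A : Language Bool) (ops : List (ClOp (Fin N))) (h : ∀ op ∈ ops, op.WF)
    (Fs Fz : List (Fin N)) (w : QReg N) :
    (phaseKickCircuit ops h Fs Fz).toMatrix A *ᵥ basisState w = (Complex.I ^ phaseKickExp ops Fs Fz w) • basisState w := by
  have e : phaseKickCircuit ops h Fs Fz =
      (((⟨revCompile (toRevList ops h)⟩ : QCircuit cliffordT N).append (sLayer Fs)).append (zLayer Fz)).append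
        ⟨revCompile (toRevList ops.reverse (wf_reverse h))⟩ := by
    simp [phaseKickCircuit, QCircuit.append, sLayer, zLayer, List.append_assoc]
  rw [e, QCircuit.toMatrix_append, QCircuit.toMatrix_append, QCircuit.toMatrix_append, ← Matrix.mulVec_mulVec,
    ← Matrix.mulVec_mulVec, ← Matrix.mulVec_mulVec, revCompile_mulVec_basisState, revEval_toRevList, sLayer_mulVec_basisState,
    Matrix.mulVec_smul, zLayer_mulVec_basisState, Matrix.mulVec_smul, Matrix.mulVec_smul, revCompile_mulVec_basisState,
    revEval_toRevList, clEval_reverse_clEval ops h, smul_smul, phaseKickExp, pow_add, mul_comm]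

/-- **The phase-kick program is the diagonal phase matrix `phaseDiag (phaseKickExp ops Fs Fz)`.**
[cite: NielsenChuang2010, §3.2.5] -/
theorem phaseKickCircuit_toMatrix (A : Language Bool) (ops : List (ClOp (Fin N))) (h : ∀ op ∈ ops, op.WF) (Fs Fz : List (Fin N)) :
    (phaseKickCircuit ops h Fs Fz).toMatrix A = phaseDiag (phaseKickExp ops Fs Fz) :=
  matrix_ext_of_mulVec_basisState fun w => by rw [phaseKickCircuit_mulVec_basisState, phaseDiag_mulVec_basisState]

/-- The phase-kick program is oracle-free. [folklore] -/
theorem phaseKickCircuit_isOracleFree (ops : List (ClOp (Fin N))) (h : ∀ op ∈ ops, op.WF) (Fs Fz : List (Fin N)) :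
    (phaseKickCircuit ops h Fs Fz).IsOracleFree := by
  intro g hg
  simp only [phaseKickCircuit, List.mem_append, sLayer, zLayer, List.mem_map, List.mem_flatMap, List.mem_cons,
    List.not_mem_nil, or_false] at hg
  rcases hg with ((hg | ⟨f, _, rfl⟩) | ⟨f, _, (rfl | rfl)⟩) | hg
  · exact revCompile_isOracleFree _ g hg
  · exact sOn_isOracleFree f
  · exact sOn_isOracleFree f
  · exact sOn_isOracleFree f
  · exact revCompile_isOracleFree _ g hg

end Literature.Computability.QuantumComplexity

end
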